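import Mathlib.NumberTheory.Cyclotomic.Basic
import Literature.NumberTheory.EllipticCurves.Wuthrich2014.ReducibleDivisibilityCyclotomicThree
import HarnessLib

/-!
# Wuthrich 2014, Thm. 16 for an odd prime `p`, read over `K = ℚ(ζ_p)`:
# `char_{Λ(Γ)} X(E/ℚ(ζ_{p^∞})) ∋ u · ∏_{i mod p−1} L_p(E, ω^i, T)` (all `p − 1` branches)

Source: C. Wuthrich, *On the integrality of modular symbols and Kato's Euler system for elliptic
curves*, Doc. Math. 19 (2014) 381–402 [Wuthrich2014], **Theorem 16** (p. 397), with §5 (p. 397: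
the Selmer group over `ℚ(ζ_{p^n})`, `X(E)` = the dual of the limit), §1 Thm. 3 ("We formulate it
here for the full cyclotomic `ℤ_p^×`-extension") and §3 (p. 390: "Any `Λ`-module `M` comes
equipped with an action by the group `Δ = Gal(ℚ(ζ_p)/ℚ)` and we split `M` up into the eigenspaces
`M = ⊕_{i=0}^{p−2} M_i` where `Δ` acts on `M_i = M^{(−i)Δ}` by the `i`-th power of the Teichmüller
character"; `Λ = ℤ_p[Δ]⟦Γ⟧`), Lemma 17 and Cor. 18 (p. 398: `L_p(E) ∈ Λ`). ONE NAMED FACT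
(`def … : Prop`, nothing asserted, D-0014): Theorem 16 for an arbitrary odd prime `p` of good
ordinary reduction, transcribed WITHOUT any descent — the `p`-general form announced as
`TODO(general form)` in the `p = 3` sibling `charIdeal_dvd_padicLFunction_cyclotomicThree` (same
module shape, same period normalisation; at `p = 3` the product below has the two factors
`L₃(E,ω⁰,T) = padicLFunction f α` (`padicLFunctionBranch_zero`) and `L₃(E,ω¹,T)` of the sibling).

## The reading (why this transcription is verbatim up to semisimple bookkeeping)

Theorem 16 (p. 397): "Let `E/ℚ` be an elliptic curve and let `p > 2` be a prime. Suppose that `E`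
has semi-stable reduction at `p` and that `E[p]` is reducible as a `G_ℚ`-module. Then
`char_Λ X(E)` divides the ideal generated by `L_p(E)`." Here (§3, p. 390; §5, p. 397)
`Λ = ℤ_p⟦G⟧` is "the Iwasawa algebra of the cyclotomic `ℤ_p^×`-extension of `ℚ`",
`G = Gal(ℚ(ζ_{p^∞})/ℚ) ≅ ℤ_p^× = Δ × Γ` (`Δ ≅ (ℤ/p)^×`, `Γ = 1 + pℤ_p`), `X(E)` is the Pontryagin
dual of `lim_n Sel(E/ℚ(ζ_{p^n}))` (the classical Selmer groups, "defined as usual as the elements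
… that are locally in the image of the points", p. 397; "If the reduction is good ordinary,
theorem 17.4 in [8] shows that `X(E)` is `Λ`-torsion", p. 397), and `L_p(E) ∈ Λ` (Cor. 18) is the
analytic `p`-adic `L`-function of `E`, i.e. the Mazur–Swinnerton-Dyer measure `μ_E` on `ℤ_p^×`
built from the modular symbols `[r]^±_E` normalised by the Néron periods `Ω^±_E` (p. 381).

**Take `K := ℚ(ζ_p)`.** The fields `ℚ(ζ_{p^{n+1}})`, `n ≥ 0`, are exactly the layers of the
cyclotomic `ℤ_p`-extension `K_∞ = ℚ(ζ_{p^∞})` of the NUMBER FIELD `K`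
(`[ℚ(ζ_{p^{n+1}}) : K] = p^n`), so `lim_n Sel(E/ℚ(ζ_{p^n})) = Sel_{p^∞}(E/K_∞)` and `X(E)` IS the
Iwasawa module `X(E/K_∞)` of `E_K` over the cyclotomic `ℤ_p`-extension of `K` — the tree's
`WeierstrassCurve.SelmerDualData` for a `K`-model of `E_K`, `κ : ZpExtension K p` cyclotomic, with
`T = γ − 1` for `γ ∈ Γ_K` mapping to the topological generator `χ_p(γ) = γ_cyc = 1 + p` of
`Γ = Gal(K_∞/K) ≅ 1 + pℤ_p` (`cyclotomicGenerator p`; the image of `Γ_K` under the cyclotomic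
character is `1 + pℤ_p` since `K ∋ ζ_p`; constructed in the tree:
`Summit.….exists_isCyclotomic_isTopGenerator_cyclotomicPrime`). NO descent along
`ℚ(ζ_{p^∞}) ⊋ ℚ_∞` or to the quadratic subfield is involved.

`Λ(G) = ℤ_p[Δ]⟦Γ⟧` with `#Δ = p − 1` prime to `p`: `Λ(G) = ⊕_{i=0}^{p−2} Λ(Γ)e_i` (`e_i` the
idempotent of `ω^i`, `ω` the Teichmüller character, whose values lie in `ℤ_p`) and every
`Λ(G)`-module is `M = ⊕_i e_iM` (p. 390, "`M = ⊕_{i=0}^{p−2} M_i`"); the characteristic ideal of a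
finitely generated torsion `Λ(G)`-module is `⊕_i char(e_iM)e_i`, and "`char_Λ X(E)` divides
`(L_p(E))`" says `e_i L_p(E) ∈ char_{Λ(Γ)}(e_i X)` for every `i`. The components of the measure
`L_p(E) = μ_E` are its `p − 1` tame branches `e_i L_p ↔ L_p(E, ω^i, T) =
∫_{ℤ_p^×} ω^i(x)(1+T)^{ℓ(x)} dμ_E^{sgn ω^i}` (Mazur–Tate–Teitelbaum 1986 §I.13; the even
branches on the PLUS modular symbols, tree `padicLFunctionBranch f α i`, the odd branches on the
MINUS modular symbols, tree `padicLFunctionMinusBranch f α i`). REGARDING `X(E)` AS A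
`Λ(Γ)`-MODULE (via `Λ(Γ) ⊂ Λ(G)`; this is the structure `T = γ − 1` above),
`char_{Λ(Γ)} X(E) = ∏_i char(e_iX)` (multiplicativity of characteristic ideals over `⊕`), hence

  `char_{Λ(Γ)} X(E/K_∞) ∋ (unit) · ∏_{i=0}^{p−2} L_p(E, ω^i, T)`.

Period normalisations (the only translation made, exactly as in the `p = 3` sibling): Wuthrich's
`[r]^±_E` are normalised by the Néron periods of `E` (p. 381: `λ(r) = [r]⁺_E Ω⁺_E + [r]⁻_E Ω⁻_E i`),
the tree's `ratPlusSymbol f`/`ratMinusSymbol f` by the newform periods `Ω^±_f`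
(`plusPeriod f`, `minusPeriod f`). With `ϖ · Ω_E = Ω⁺_f` (`Ω_E = realPeriodRat = c_∞ Ω⁺_E`) and
`ϖ' · |Ω⁻(E)| = Ω⁻_f` (`|Ω⁻(E)| = imaginaryPeriodRat`; Wuthrich's `Ω⁻_E` differs from it by a
power of `2`), each of the `(p−1)/2` EVEN branches carries one factor `ϖ` and each of the `(p−1)/2`
ODD branches one factor `ϖ'`, so the Néron-normalised product is
`u · ϖ^{(p−1)/2} ϖ'^{(p−1)/2} · ∏_{i even} padicLFunctionBranch f α i · ∏_{i odd} padicLFunctionMinusBranch f α i`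
for a `p`-adic unit `u` (signs, `c_∞ ∈ {1,2}`, powers of `2` — units as `p` is odd), invisible in
the ideal statement and kept as an explicit unit.

Hypotheses transcribed: `E = V` globally minimal over `ℚ`, `p ≠ 2`, good ordinary at `p`
(`IsOrdinaryAt V p`; Thm. 16 is printed for semi-stable reduction — only the good case is
transcribed here, as in the siblings; for `p` good with `E[p]` reducible the reduction is ordinary,
§5 p. 397), `E[p]` reducible (`¬ V.HasIrreducibleModPGaloisRep p`), `K` a cyclotomic extension
`{p}` of `ℚ` (Mathlib `IsCyclotomicExtension {p} ℚ K`, i.e. `K = ℚ(ζ_p)`), `V'` any `K`-model of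
`E_K` (`C • V.baseChange K = V'`), `κ` the cyclotomic `ℤ_p`-extension of `K` with topological
generator `γ` matching the cyclotomic variable (`χ_p(γ) · ζ = 1 + p`, `ζ` torsion), `f` the
newform of `E`, `α = unitRoot V p`, `D` a Pontryagin-dual datum of `Sel_{p^∞}(E/K_∞)`.
Conclusion: `X(E/K_∞)` is `Λ`-torsion and
`u ϖ^{(p−1)/2} ϖ'^{(p−1)/2} · ∏_{i<p−1} L_p(E,ω^i,T) = ι g` for some `g ∈ char_{Λ(Γ)} X(E/K_∞)`,
the `i`-th factor being `padicLFunctionBranch f α i` for even `i` and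
`padicLFunctionMinusBranch f α i` for odd `i`.

What is NOT here: the multiplicative case and its `I`-factor, `p = 2`, and any proof (Kato's Euler
system is not in Mathlib). No `_holds` is to be expected.
-- TODO(general form): Thm. 16 for multiplicative reduction at `p` (with the factor `I` in the
-- split case), all branches.

Consumer: the BSD rank-≤1 residual cell (`b2b-bsdres`, sub-cell additive-p4, line V19): with
Greenberg's Euler-characteristic formula over `F = ℚ(ζ_p)`
(`Greenberg1999.thm41_charValue_rankZero_numberField`), the bottom-layer control finiteness and the
restriction `ℚ(√p*) → ℚ(ζ_p)` this fact bounds `#Ш(E/ℚ)[p^∞] · #Ш(E^{(p*)}/ℚ)[p^∞]` for the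
ADDITIVE twist `E^{(p*)}` (class X3 at a potentially good ordinary `p ≥ 5` with `e = 2`) from
published statements only, the `p − 3` non-quadratic branch values entering as explicit per-pair terms.
-/

set_option autoImplicit false

noncomputable section

open scoped Classical MatrixGroups ModularForm

open CongruenceSubgroup WeierstrassCurve Literature.NumberTheory.EllipticCurves
  Literature.NumberTheory.EllipticCurves.ModularForms
  Literature.NumberTheory.GaloisRepresentations

namespace Literature.NumberTheory.EllipticCurves.Wuthrich2014

/-- **Wuthrich 2014, Theorem 16 for an odd prime `p`, good ordinary case, read over `K = ℚ(ζ_p)`: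
`char_{Λ(Γ)} X(E/ℚ(ζ_{p^∞})) ∋ u · ∏_{i=0}^{p−2} L_p(E, ω^i, T)`.** As printed (Doc. Math. 19
(2014), Thm. 16, p. 397): "Let `E/ℚ` be an elliptic curve and let `p > 2` be a prime. Suppose that
`E` has semi-stable reduction at `p` and that `E[p]` is reducible as a `G_ℚ`-module. Then
`char_Λ X(E)` divides the ideal generated by `L_p(E)`." — with `Λ = ℤ_p⟦Gal(ℚ(ζ_{p^∞})/ℚ)⟧`
(§1 Thm. 3: "for the full cyclotomic `ℤ_p^×`-extension"; §3 p. 390), `X(E)` the dual of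
`lim_n Sel(E/ℚ(ζ_{p^n}))` (§5 p. 397) and `L_p(E) ∈ Λ` (Cor. 18, p. 398) the Néron-normalised
Mazur–Swinnerton-Dyer measure on `ℤ_p^×` (p. 381). The tower `ℚ(ζ_{p^{n+1}})` is the cyclotomic
`ℤ_p`-extension `K_∞` of the number field `K = ℚ(ζ_p)`, so `X(E) = X(E/K_∞)` is the tree's
Iwasawa module of (any `K`-model `V'` of) `E_K` for `κ : ZpExtension K p` cyclotomic, `T = γ − 1`,
`χ_p(γ) = 1 + p`; and since `Λ = ⊕_{i=0}^{p−2} Λ(Γ)e_i` (`#Δ = p − 1` prime to `p`; p. 390 "we split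
`M` up into the eigenspaces `M = ⊕_{i=0}^{p−2} M_i` where `Δ` acts on `M_i` by the `i`-th power of
the Teichmüller character") the printed divisibility says `e_iL_p(E) ∈ char(e_iX)` for each `i`,
whence — characteristic ideals being multiplicative over `X = ⊕ e_iX` —
`char_{Λ(Γ)} X(E/K_∞) ∋ ∏_i L_p(E,ω^i,T)`, the `p − 1` tame branches of `μ_E`
(Mazur–Tate–Teitelbaum 1986 §I.13: even branches on `[·]⁺`, odd branches on `[·]⁻`). In the tree's
normalisation by the newform periods (`ϖ · Ω_E = Ω⁺_f`, `ϖ' · |Ω⁻(E)| = Ω⁻_f`, one factor per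
branch of the matching parity): `X(E/K_∞)` is `Λ`-torsion (§5 p. 397, via Kato Thm. 17.4) and
`u · ϖ^{(p−1)/2} ϖ'^{(p−1)/2} · ∏_{i<p−1} B_i = ι g` for some `g ∈ char_Λ X(E/K_∞)` and a unit
`u ∈ ℤ_p^×` (signs, `c_∞`, powers of `2`), where `B_i = padicLFunctionBranch f α i` (`i` even) or
`padicLFunctionMinusBranch f α i` (`i` odd), `α = unitRoot V p`, `ι = iwasawaToPowerSeries p`.
Transcribed for good ordinary `p` only (`IsOrdinaryAt V p`; printed for semi-stable `p`). The
`p = 3` instance is the sibling `charIdeal_dvd_padicLFunction_cyclotomicThree`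
(`padicLFunctionBranch_zero`). Named fact, nothing asserted.
[cite: Wuthrich2014, Thm. 16 (p. 397), §5 (p. 397), §3 (p. 390), Cor. 18 (p. 398)]
[cite: MazurTateTeitelbaum1986Invent, §I.13] -/
def charIdeal_dvd_padicLFunction_cyclotomicPrime : Prop :=
  ∀ (p : ℕ) [Fact p.Prime] (V : WeierstrassCurve ℚ) [V.IsElliptic] [V.IsGloballyMinimal]
    (K : Type) [Field K] [NumberField K] [IsCyclotomicExtension {p} ℚ K]
    (V' : WeierstrassCurve K) [V'.IsElliptic]
    {κ : ZpExtension K p} {γ : Field.absoluteGaloisGroup K} {N : ℕ} [NeZero N]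
    {f : CuspForm (Gamma0 N) 2},
    p ≠ 2 → IsOrdinaryAt V p → ¬ V.HasIrreducibleModPGaloisRep p →
    (∃ C : VariableChange K, C • V.baseChange K = V') →
    κ.IsCyclotomic → κ.IsTopGenerator γ →
    (∃ ζ : ℤ_[p]ˣ, IsOfFinOrder ζ ∧
      ((GaloisRep.cyclotomicCharacter K p γ * ζ : ℤ_[p]ˣ) : ℤ_[p]) =
        (cyclotomicGenerator p : ℤ_[p])) →
    IsNewformOf V f →
    ∀ (D : V'.SelmerDualData κ γ) (ϖ ϖ' : ℚ),
      (ϖ : ℝ) * V.realPeriodRat = plusPeriod f →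
      (ϖ' : ℝ) * V.imaginaryPeriodRat = minusPeriod f →
      D.IsTorsion ∧
      ∃ g ∈ D.charIdeal, ∃ u : ℤ_[p]ˣ,
        iwasawaToPowerSeries p g =
          PowerSeries.C (((u : ℤ_[p]) : ℚ_[p]) * (ϖ : ℚ_[p]) ^ (p / 2) * (ϖ' : ℚ_[p]) ^ (p / 2)) *
            ∏ i ∈ Finset.range (p - 1),
              (if Even i then padicLFunctionBranch f ((unitRoot V p : ℤ_[p]) : ℚ_[p]) i
                else padicLFunctionMinusBranch f ((unitRoot V p : ℤ_[p]) : ℚ_[p]) i)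

end Literature.NumberTheory.EllipticCurves.Wuthrich2014

end
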